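import Summits.CriticalPhenomena.PercolationContinuityZ3.Theorems.Transplant.SkelFrmBParamsSlots
import Summits.CriticalPhenomena.PercolationContinuityZ3.Theorems.Transplant.SkelNegBParamsSlots
import Summits.CriticalPhenomena.PercolationContinuityZ3.Theorems.Transplant.SkelFrmBParamsSched
import Summits.CriticalPhenomena.PercolationContinuityZ3.Theorems.Transplant.SkelNegBParamsSched
import Summits.CriticalPhenomena.PercolationContinuityZ3.Theorems.Transplant.SkelFrm1SlotTypes
import Summits.CriticalPhenomena.PercolationContinuityZ3.Theorems.Transplant.SkelFrm1ParamsPO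
import Summits.CriticalPhenomena.PercolationContinuityZ3.Theorems.Transplant.SkelFrm1ParamsLBL
import Summits.CriticalPhenomena.PercolationContinuityZ3.Theorems.Transplant.SkelFrmBParamsKitA
import Summits.CriticalPhenomena.PercolationContinuityZ3.Theorems.Transplant.SkelFrmBParamsKitS
import Summits.CriticalPhenomena.PercolationContinuityZ3.Theorems.Transplant.SkelFrm1ParamsLF
import Summits.CriticalPhenomena.PercolationContinuityZ3.Theorems.Transplant.SkelFrm1ParamsLO
import Summits.CriticalPhenomena.PercolationContinuityZ3.Theorems.Transplant.SkelFrmBParamsLF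
import Summits.CriticalPhenomena.PercolationContinuityZ3.Theorems.Transplant.SkelFrmBParamsFineSize
import Summits.CriticalPhenomena.PercolationContinuityZ3.Theorems.Transplant.SkelFrmBParamsLO
import Summits.CriticalPhenomena.PercolationContinuityZ3.Theorems.Transplant.SkelFrmBParamsB
import Summits.CriticalPhenomena.PercolationContinuityZ3.Theorems.Transplant.SkelFrmBParamsSlotsR
import Summits.CriticalPhenomena.PercolationContinuityZ3.Theorems.Transplant.SkelFrmBParamsSlotsRS
import Summits.CriticalPhenomena.PercolationContinuityZ3.Theorems.Transplant.SkelNegBParamsReachFC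
import Summits.CriticalPhenomena.PercolationContinuityZ3.Theorems.Transplant.PlanarSkeletonFrmDefs
import Summits.CriticalPhenomena.PercolationContinuityZ3.Theorems.Transplant.SkelPhiStepIDataNS
import HarnessLib

/-!
# N2 (frames-only node `SamePDropOfSkeletonFrm₁`, OPEN) params column over `PlanarSkeletonFrm` — (ζ″) ledger, shape (B′) of record ((R-14)):
# MECHANICAL PORT of N1's `SkelNegBParamsReachFC` — chain of record `NegB`, part ReachFC: THE (C) CORRIDOR's LEDGER-DETERMINED NUMBERS under S1 (p5-g9 2026-08-21T17:53:02Z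
# (C-A8) read list) — the frame change of the small arrival box `cen ± b0` into the v-rounds' start box (`FrameChangeFine.runX_mem_Icc_of_fine` at `K := b0`):
# **`NegB.aW/Bx/bL κ Φ t … (N1 title abridged; see `SkelNegBParamsReachFC`)
builds on p205010 (kernel theorem, internal audit signed; external expert review pending) — nothing in this file uses p205010; NOTHING is claimed about the
open node `SamePDropOfSkeletonFrm₁` (`SamePDropOfSkeletonNeg₁` is CLOSED in the tree and untouched by this file).
Status sentence (coordinator 2026-08-20T04:30Z): "θ(p_c) = 0 on ℤ^d, all d ≥ 2 — kernel-verified (Lean 4/Mathlib, standard axioms); internal adversarial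
audit SIGNED 2026-08-20 04:29Z; external expert review pending."
Lane `prim-bschramm-*`, seat `prim-bschramm-stmt` (gen 19); helper file (`--supports stmt-CriticalPhenomena-4575 --as helper`); ledger HOME/prim-bschramm-stmt/FRM-PARAMS.md §9, (R-14).
PORT RULES (HOME/prim-bschramm-stmt-g19/lean/port_frm.py, the tool of record per (R-14)): outer namespace `PlanarSkeletonNeg ↦ PlanarSkeletonFrm`, carrier binder
`(Φ : PlanarSkeletonFrm G)`, record binder `(D : Skelφ.StepI.DataNS V)` (the selectors travel IN the record, `SkelPhiStepIDataNS`); section variables INLINED into every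
declaration header; inner namespaces (`Neg`/`NegB`/`KS`/…) and every short name KEPT so all cross-references resolve unchanged; declarations using no section variable are
NOT re-declared (N1's originals are referenced fully qualified). Mathematical content, proofs, docstrings and citations are N1's, verbatim, except where stated next.
SELECTORS IN THIS FILE ((R-14) condition of record — joint selection, `D.sN`'s first argument is the literal handed to `D.sM`): none (pure port; the pairs are read through their N1 names).
N1 HEADER (kept for the reader):
helper file (`--supports stmt-CriticalPhenomena-4575 --as helper`); ledger HOME/prim-bschramm-stmt/NEG-PARAMS.md v0.12.
* §1 `ceil_mul_le` (`x ≤ d·(x/d + 1)` for `0 < d`), `prF_pos`, `b0_le_two`; §2 **`aW`, `Bx`, `bL`** + **`ha_R`, `hBx_R`, `hb_R`** (the three hypotheses of `runX_mem_Icc_of_fine` /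
  `reachOblAtHN_negCorridor1` with `K₀ := b0 0`, `K₁ := b0 1`), `aW_nonneg/bL_pos`; §3 **`layer_R`** (and `eleven_RA'_le_ℓL`).
[cite: KozmaNitzan2024, §4 Lemma 12 (pp. 23–25)] [cite: MartineauTassion2017, §4.3 Lemma 4.2]
-/

noncomputable section

open scoped Classical

namespace Summit.CriticalPhenomena.PercolationContinuityZ3.Theorems.Transplant

namespace PlanarSkeletonFrm

namespace NegB

open Literature.Probability.Percolation Literature.Probability.LatticeModels SimpleGraph
open SkelConc (Consts)
open Skelφ.StepI (DataN)
open TwoAxis.Para (modulus)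
open Skelφ (shearUnit shearUnit_pos)
open Neg

/-! ## §1 Arithmetic and positivity -/

export PlanarSkeletonNeg.NegB (ceil_mul_le)

section Values

/-- **Positivity of the frame record** under the numeric long clause: `0 < A`, `1 ≤ n`, `0 < modulus n h vα vβ`, `0 < c₀`, `0 < c₁`, `0 < D`. [folklore] -/
theorem prF_pos (κ : Consts) {V : Type} [DecidableEq V] [Countable V] {G : SimpleGraph V} [G.LocallyFinite] (Φ : PlanarSkeletonFrm G) (t : V) (p : unitInterval) (D : Skelφ.StepI.DataNS V) (g : ℕ) (f : ℕ) (hN : EqNumL κ Φ t p D g f) :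
    0 < (prF κ Φ t p D g f).A ∧ 1 ≤ (prF κ Φ t p D g f).n ∧ 0 < modulus (prF κ Φ t p D g f).n (prF κ Φ t p D g f).h (prF κ Φ t p D g f).vα (prF κ Φ t p D g f).vβ ∧
      0 < (prF κ Φ t p D g f).c₀ ∧ 0 < (prF κ Φ t p D g f).c₁ ∧ 0 < (prF κ Φ t p D g f).D := by
  obtain ⟨hn1, hℓ1⟩ := one_le_of_eqNumL κ Φ t p D g f hN
  obtain ⟨hA, hn, hh, hvα, hvβ, -, -, -⟩ := prF_fields κ Φ t p D g f
  have hm : 0 < modulus (prF κ Φ t p D g f).n (prF κ Φ t p D g f).h (prF κ Φ t p D g f).vα (prF κ Φ t p D g f).vβ := by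
    rw [hn, hh, hvα, hvβ]; exact Skelφ.NegPrm.modulus_vβOf_pos hn1 hℓ1 _ _
  refine ⟨by rw [hA]; norm_num, by rw [hn]; exact_mod_cast hn1, hm, (prF_c_pos κ Φ t p D g f).1, (prF_c_pos κ Φ t p D g f).2, ?_⟩
  rw [prF_D]; unfold TwoAxis.Para.detD; rw [hA]; positivity

end Values
end NegB
end PlanarSkeletonFrm
end Summit.CriticalPhenomena.PercolationContinuityZ3.Theorems.Transplant
end
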